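import Literature.Combinatorics.Optimization.FourierTailRandomSubset
import Literature.Combinatorics.Optimization.PseudoDensityRestrictedSquares
import HarnessLib

/-!
# Ingredients of Lee–Raghavendra–Steurer 2015, Lemma 3.6 (low/high split of `‖A(S)B(x)‖_F²`), PROVED

LRS Lemma 3.6 (arXiv:1411.6317 p. 16) — with Lemma 3.7 (`FourierTailRandomSubset.lean`, proved) the
two halves of the printed proof of the degree-reduction Thm 3.5 (the named fact
`LeeRaghavendraSteurer2015_thm35` of `SeparatingFunctionalPsdRank.lean`) — reads: with
`τ = max_S ‖A(S)²‖`,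
`E_{S,x} D(x_S)‖A(S)B(x)‖_F² ≥ −2√τ‖D‖_∞ (E_{S,x}‖B_{S,hi}(x)‖_F²)^{1/2} (E_{S,x}‖A(S)B(x)‖_F²)^{1/2}`.
Its printed proof has four steps; this file PROVES the three matrix/Fourier ones (the fourth,
"since … `D` is a degree-`d` pseudo-density, the expectation `E D(x_S)‖A B_low‖_F²` is non-negative",
is `PseudoDensityRestrictedSquares.lean`) and the two elementary `ℓ²` inequalities it invokes:

* `frobSq_eq_trace`, `frobSq_mul_le_of_sq_le` — "`‖A B_hi‖_F² ≤ max_S ‖A(S)²‖·‖B_hi‖_F²`": for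
  symmetric `A` with `A² ⪯ τ Id`, `‖A X‖_F² = Tr(Xᵀ A² X) ≤ τ ‖X‖_F²`;
* `fourierLowPart`, `cubeFourierCoeff_fourierLowPart/_fourierHighPart`, `sum_fourierLowPart_mul_fourierHighPart`
  — "the Fourier transforms of `x ↦ B_{S,low}(x)` and `x ↦ B_{S,hi}(x)` have disjoint support …
  Therefore `E B_low B_hiᵀ = 0`", entrywise: `Σ_x g_{S,low}(x) h_{S,hi}(x) = 0`;
* `sum_frobSq_mul_split` — "`E‖A B_low‖_F² + E‖A B_hi‖_F² = E‖AB‖_F²`" (for every fixed `S`,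
  summing over `x`);
* `cubeFourierCoeff_mulVec_fourierLowPart_eq_zero` + `IsPseudoDensity.sum_cubeRestrict_mul_frobSq_low_nonneg`
  — the entries of `A·B_{S,low}` have degree `≤ d/2` in the variables `S`, hence
  `Σ_x D(x_S)‖A B_{S,low}(x)‖_F² ≥ 0`;
* `abs_sqrt_sum_sq_sub_sqrt_sum_sq_le` (reverse triangle inequality in finite `ℓ²`: "The third step
  used the triangle inequality") and `sqrt_sum_add_sq_le` (Minkowski), both from Cauchy–Schwarz.

What remains for `LeeRaghavendraSteurer2015_thm35` is the assembly (p. 16–17): the Cauchy–Schwarz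
chain `|E D(‖AB‖² − ‖AB_low‖²)| ≤ 2‖D‖_∞ (E‖AB_hi‖²)^{1/2}(E‖AB‖²)^{1/2}` and Lemma 3.7.

Source: [LeeRaghavendraSteurer2015] held text `paper:arxiv-1411.6317`, Lemma 3.6 and its proof
(p. 16), Thm 3.5 (p. 16).  One definition (`fourierLowPart`), no facts.
-/

open Finset Matrix
open scoped MatrixOrder
open Literature.Probability.RandomGraphs.LowDegree (walsh)
open Literature.Computability.Complexity.LowDegree (cubeFourierCoeff sum_cubeFourierCoeff_mul_walsh)

namespace Literature.Combinatorics.Optimization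

/-! ### Two `ℓ²` inequalities from Cauchy–Schwarz -/

/-- Reverse triangle inequality in finite `ℓ²`: `|‖u‖ − ‖v‖| ≤ ‖u − v‖` for
`‖u‖ = √(Σ u_i²)`. [cite: LeeRaghavendraSteurer2015, Lemma 3.6 proof (p. 16: "The third step used the triangle inequality")] -/
theorem abs_sqrt_sum_sq_sub_sqrt_sum_sq_le {ι : Type*} (s : Finset ι) (u v : ι → ℝ) :
    |Real.sqrt (∑ i ∈ s, u i ^ 2) - Real.sqrt (∑ i ∈ s, v i ^ 2)| ≤
      Real.sqrt (∑ i ∈ s, (u i - v i) ^ 2) := by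
  have hu : 0 ≤ ∑ i ∈ s, u i ^ 2 := sum_nonneg fun i _ => sq_nonneg _
  have hv : 0 ≤ ∑ i ∈ s, v i ^ 2 := sum_nonneg fun i _ => sq_nonneg _
  have hw : 0 ≤ ∑ i ∈ s, (u i - v i) ^ 2 := sum_nonneg fun i _ => sq_nonneg _
  have hcs := Real.sum_mul_le_sqrt_mul_sqrt s u v
  have hexp : ∑ i ∈ s, (u i - v i) ^ 2 =
      ∑ i ∈ s, u i ^ 2 + ∑ i ∈ s, v i ^ 2 - 2 * ∑ i ∈ s, u i * v i := by
    rw [← sum_add_distrib, mul_sum, ← sum_sub_distrib]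
    exact sum_congr rfl fun i _ => by ring
  set a := Real.sqrt (∑ i ∈ s, u i ^ 2) with ha
  set b := Real.sqrt (∑ i ∈ s, v i ^ 2) with hb
  set c := Real.sqrt (∑ i ∈ s, (u i - v i) ^ 2) with hc
  have hc0 : 0 ≤ c := Real.sqrt_nonneg _
  have haa : a ^ 2 = ∑ i ∈ s, u i ^ 2 := Real.sq_sqrt hu
  have hbb : b ^ 2 = ∑ i ∈ s, v i ^ 2 := Real.sq_sqrt hv
  have hcc : c ^ 2 = ∑ i ∈ s, (u i - v i) ^ 2 := Real.sq_sqrt hw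
  have key : (a - b) ^ 2 ≤ c ^ 2 := by
    rw [hcc, hexp, ← haa, ← hbb]
    nlinarith [hcs]
  exact abs_le_of_sq_le_sq key hc0

/-- Minkowski's inequality in finite `ℓ²`: `‖a + b‖ ≤ ‖a‖ + ‖b‖`.
[cite: LeeRaghavendraSteurer2015, Lemma 3.6 proof (p. 16: "we applied Cauchy–Schwarz")] -/
theorem sqrt_sum_add_sq_le {ι : Type*} (s : Finset ι) (a b : ι → ℝ) :
    Real.sqrt (∑ i ∈ s, (a i + b i) ^ 2) ≤
      Real.sqrt (∑ i ∈ s, a i ^ 2) + Real.sqrt (∑ i ∈ s, b i ^ 2) := by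
  have ha : 0 ≤ ∑ i ∈ s, a i ^ 2 := sum_nonneg fun i _ => sq_nonneg _
  have hb : 0 ≤ ∑ i ∈ s, b i ^ 2 := sum_nonneg fun i _ => sq_nonneg _
  have hcs := Real.sum_mul_le_sqrt_mul_sqrt s a b
  have hexp : ∑ i ∈ s, (a i + b i) ^ 2 =
      ∑ i ∈ s, a i ^ 2 + ∑ i ∈ s, b i ^ 2 + 2 * ∑ i ∈ s, a i * b i := by
    rw [← sum_add_distrib, mul_sum, ← sum_add_distrib]
    exact sum_congr rfl fun i _ => by ring
  rw [Real.sqrt_le_left (add_nonneg (Real.sqrt_nonneg _) (Real.sqrt_nonneg _)), hexp, add_sq,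
    Real.sq_sqrt ha, Real.sq_sqrt hb]
  nlinarith [hcs]

/-! ### Frobenius norms through the Loewner order -/

variable {p q : ℕ}

/-- `‖X‖_F² = Tr(Xᵀ X)`. [cite: LeeRaghavendraSteurer2015, §2.1 (p. 10: "‖A‖_F = √Tr(AᵀA)")] -/
theorem frobSq_eq_trace (X : Matrix (Fin p) (Fin q) ℝ) : frobSq X = (Xᵀ * X).trace := by
  unfold frobSq Matrix.trace
  simp only [diag_apply, mul_apply, transpose_apply]
  rw [sum_comm]
  exact sum_congr rfl fun j _ => sum_congr rfl fun i _ => by ring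

/-- `frobSq` is nonnegative. [cite: LeeRaghavendraSteurer2015, §2.1 (p. 10)] -/
theorem frobSq_nonneg (X : Matrix (Fin p) (Fin q) ℝ) : 0 ≤ frobSq X :=
  sum_nonneg fun _ _ => sum_nonneg fun _ _ => sq_nonneg _

/-- **"`‖A B_hi‖_F² ≤ max_S ‖A(S)²‖·‖B_hi‖_F²`":** for symmetric `A` with `A² ⪯ τ·Id`,
`‖A X‖_F² ≤ τ ‖X‖_F²`. [cite: LeeRaghavendraSteurer2015, Lemma 3.6 proof (p. 16: "‖A B_hi‖_F² ≤ max_S ‖A(S)²‖ · ‖B_hi‖_F²")] -/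
theorem frobSq_mul_le_of_sq_le {A : Matrix (Fin p) (Fin p) ℝ} (hA : A.IsSymm) {τ : ℝ}
    (hτ : A * A ≤ τ • (1 : Matrix (Fin p) (Fin p) ℝ)) (X : Matrix (Fin p) (Fin q) ℝ) :
    frobSq (A * X) ≤ τ * frobSq X := by
  rw [frobSq_eq_trace, frobSq_eq_trace, transpose_mul, hA.eq]
  -- `Xᵀ A A X ⪯ τ Xᵀ X`
  rw [Matrix.le_iff] at hτ
  have h := hτ.conjTranspose_mul_mul_same X
  rw [conjTranspose_eq_transpose_of_trivial, Matrix.mul_sub, Matrix.sub_mul, Matrix.mul_smul,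
    Matrix.mul_one, Matrix.smul_mul] at h
  have ht := h.trace_nonneg
  rw [trace_sub, trace_smul, smul_eq_mul] at ht
  have : (Xᵀ * A * (A * X)).trace = (Xᵀ * (A * A) * X).trace := by
    simp only [Matrix.mul_assoc]
  rw [this]
  linarith

/-! ### The low part and orthogonality of the split -/

variable {n : ℕ}

/-- The **low part above `S`** at level `d`: `g_{S,low} = g − g_{S,hi} = Σ_{|α∩S| ≤ d/2} ĝ(α) χ_α`.
[cite: LeeRaghavendraSteurer2015, Thm 3.5 proof (p. 16: "B_{S,low} is the part of B with degree at most d/2 in the variables S")] -/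
noncomputable def fourierLowPart (S : Finset (Fin n)) (d : ℕ) (g : (Fin n → Bool) → ℝ) :
    (Fin n → Bool) → ℝ :=
  fun x => g x - fourierHighPart S d g x

/-- Coefficients of the high part. [cite: LeeRaghavendraSteurer2015, Lemma 3.7 proof (p. 17)] -/
theorem cubeFourierCoeff_fourierHighPart (S : Finset (Fin n)) (d : ℕ) (g : (Fin n → Bool) → ℝ)
    (T : Finset (Fin n)) :
    cubeFourierCoeff (fourierHighPart S d g) T =
      if d / 2 < (T ∩ S).card then cubeFourierCoeff g T else 0 := by
  classical
  unfold fourierHighPart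
  rw [cubeFourierCoeff_sum_walsh]
  simp

/-- Coefficients of the low part. [cite: LeeRaghavendraSteurer2015, Thm 3.5 proof (p. 16)] -/
theorem cubeFourierCoeff_fourierLowPart (S : Finset (Fin n)) (d : ℕ) (g : (Fin n → Bool) → ℝ)
    (T : Finset (Fin n)) :
    cubeFourierCoeff (fourierLowPart S d g) T =
      if d / 2 < (T ∩ S).card then 0 else cubeFourierCoeff g T := by
  have hsub : cubeFourierCoeff (fourierLowPart S d g) T =
      cubeFourierCoeff g T - cubeFourierCoeff (fourierHighPart S d g) T := by
    unfold fourierLowPart Literature.Computability.Complexity.LowDegree.cubeFourierCoeff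
    rw [← sub_div, ← sum_sub_distrib]
    congr 1
    exact sum_congr rfl fun x _ => by ring
  rw [hsub, cubeFourierCoeff_fourierHighPart]
  split_ifs <;> ring

/-- **Orthogonality of the split** ("the Fourier transforms of `B_{S,low}` and `B_{S,hi}` have disjoint
support … Therefore `E B_low B_hiᵀ = 0`"), entrywise: `Σ_x g_{S,low}(x) h_{S,hi}(x) = 0`.
[cite: LeeRaghavendraSteurer2015, Lemma 3.6 proof (p. 16)] -/
theorem sum_fourierLowPart_mul_fourierHighPart (S : Finset (Fin n)) (d : ℕ)
    (g h : (Fin n → Bool) → ℝ) :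
    ∑ x : Fin n → Bool, fourierLowPart S d g x * fourierHighPart S d h x = 0 := by
  have hE : cubeExpect (fun x => fourierLowPart S d g x * fourierHighPart S d h x) = 0 := by
    rw [cubeExpect_mul_eq_sum_cubeFourierCoeff]
    refine sum_eq_zero fun T _ => ?_
    rw [cubeFourierCoeff_fourierLowPart, cubeFourierCoeff_fourierHighPart]
    split_ifs <;> ring
  unfold cubeExpect at hE
  rcases div_eq_zero_iff.1 hE with h0 | h0
  · exact h0
  · exact absurd h0 (by positivity)

/-- The low/high split of a matrix-valued function, entrywise. [cite: LeeRaghavendraSteurer2015, Thm 3.5 proof (p. 16: "we decompose B into two parts B = B_{S,low} + B_{S,hi}")] -/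
theorem matrix_split (S : Finset (Fin n)) (d : ℕ) (B : (Fin n → Bool) → Matrix (Fin p) (Fin q) ℝ)
    (x : Fin n → Bool) :
    B x = (Matrix.of fun i j => fourierLowPart S d (fun y => B y i j) x) +
      Matrix.of fun i j => fourierHighPart S d (fun y => B y i j) x := by
  ext i j
  simp [fourierLowPart]

/-- **"`E‖A B_low‖_F² + E‖A B_hi‖_F² = E‖AB‖_F²`"** for each fixed `S` (the cross term vanishes by
orthogonality after summing over `x`). [cite: LeeRaghavendraSteurer2015, Lemma 3.6 proof (p. 16)] -/
theorem sum_frobSq_mul_split (S : Finset (Fin n)) (d : ℕ) (A : Matrix (Fin p) (Fin p) ℝ)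
    (B : (Fin n → Bool) → Matrix (Fin p) (Fin q) ℝ) :
    ∑ x : Fin n → Bool, frobSq (A * B x) =
      ∑ x : Fin n → Bool, frobSq (A * Matrix.of fun i j => fourierLowPart S d (fun y => B y i j) x) +
      ∑ x : Fin n → Bool, frobSq (A * Matrix.of fun i j => fourierHighPart S d (fun y => B y i j) x) := by
  -- abbreviations for the two parts
  set L : (Fin n → Bool) → Matrix (Fin p) (Fin q) ℝ :=
    fun x => Matrix.of fun i j => fourierLowPart S d (fun y => B y i j) x with hL
  set H : (Fin n → Bool) → Matrix (Fin p) (Fin q) ℝ :=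
    fun x => Matrix.of fun i j => fourierHighPart S d (fun y => B y i j) x with hH
  have hsplit : ∀ x, B x = L x + H x := fun x => matrix_split S d B x
  -- pointwise expansion of the square
  have hpt : ∀ x, frobSq (A * B x) = frobSq (A * L x) + frobSq (A * H x) +
      2 * ∑ i, ∑ k, (A * L x) i k * (A * H x) i k := by
    intro x
    rw [hsplit x, Matrix.mul_add]
    unfold frobSq
    simp only [Matrix.add_apply, mul_sum, ← sum_add_distrib]
    exact sum_congr rfl fun i _ => sum_congr rfl fun k _ => by ring
  simp_rw [hpt]
  rw [sum_add_distrib, sum_add_distrib]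
  -- the cross term vanishes
  have hcross : ∑ x : Fin n → Bool, 2 * ∑ i, ∑ k, (A * L x) i k * (A * H x) i k = 0 := by
    rw [← mul_sum]
    have : ∑ x : Fin n → Bool, ∑ i, ∑ k, (A * L x) i k * (A * H x) i k = 0 := by
      rw [sum_comm]
      refine sum_eq_zero fun i _ => ?_
      rw [sum_comm]
      refine sum_eq_zero fun k _ => ?_
      -- expand the two matrix products
      have hexp : ∀ x, (A * L x) i k * (A * H x) i k =
          ∑ j, ∑ j', A i j * A i j' * (L x j k * H x j' k) := by
        intro x
        rw [mul_apply, mul_apply, sum_mul_sum]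
        exact sum_congr rfl fun j _ => sum_congr rfl fun j' _ => by ring
      simp_rw [hexp]
      rw [sum_comm]
      refine sum_eq_zero fun j _ => ?_
      rw [sum_comm]
      refine sum_eq_zero fun j' _ => ?_
      rw [← mul_sum]
      have h0 : ∑ x : Fin n → Bool, L x j k * H x j' k = 0 := by
        simp only [hL, hH, Matrix.of_apply]
        exact sum_fourierLowPart_mul_fourierHighPart S d (fun y => B y j k) (fun y => B y j' k)
      rw [h0, mul_zero]
    rw [this, mul_zero]
  rw [hcross, add_zero]

/-! ### The low part has degree `≤ d/2` in the variables `S`, so the pseudo-density is nonnegative on `‖A B_low‖_F²` -/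

/-- The entries of `A · B_{S,low}` have no Fourier coefficients with `|α ∩ S| > d/2`.
[cite: LeeRaghavendraSteurer2015, Lemma 3.6 proof (p. 16: "x ↦ ‖A(S)B_{S,low}(x)‖_F² is a sum of squares of polynomials of degree at most d/2 in the variables S")] -/
theorem cubeFourierCoeff_mul_fourierLowPart_eq_zero (S : Finset (Fin n)) (d : ℕ)
    (A : Matrix (Fin p) (Fin p) ℝ) (B : (Fin n → Bool) → Matrix (Fin p) (Fin q) ℝ)
    (i : Fin p) (k : Fin q) {α : Finset (Fin n)} (hα : d / 2 < (α ∩ S).card) :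
    cubeFourierCoeff
      (fun x => (A * Matrix.of fun i' j => fourierLowPart S d (fun y => B y i' j) x) i k) α = 0 := by
  have hexp : (fun x => (A * Matrix.of fun i' j => fourierLowPart S d (fun y => B y i' j) x) i k) =
      fun x => ∑ j, A i j * fourierLowPart S d (fun y => B y j k) x := by
    funext x
    rw [mul_apply]
    rfl
  rw [hexp, cubeFourierCoeff_sum_mul]
  refine sum_eq_zero fun j _ => ?_
  rw [cubeFourierCoeff_fourierLowPart, if_pos hα, mul_zero]

/-- **`Σ_x D(x_S) ‖A B_{S,low}(x)‖_F² ≥ 0`** for a degree-`d` pseudo-density `D` (the positivity step of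
Lemma 3.6, matrix form). [cite: LeeRaghavendraSteurer2015, Lemma 3.6 proof (p. 16: "the expectation E D(x_S)‖A B_low‖_F² is non-negative")] -/
theorem IsPseudoDensity.sum_cubeRestrict_mul_frobSq_low_nonneg {m d : ℕ} {D : (Fin m → Bool) → ℝ}
    (hD : IsPseudoDensity d D) (S : {S : Finset (Fin n) // S.card = m})
    (A : Matrix (Fin p) (Fin p) ℝ) (B : (Fin n → Bool) → Matrix (Fin p) (Fin q) ℝ) :
    0 ≤ ∑ x : Fin n → Bool, D (cubeRestrict S x) *
      frobSq (A * Matrix.of fun i j => fourierLowPart S.1 d (fun y => B y i j) x) := by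
  unfold frobSq
  simp only [mul_sum]
  rw [sum_comm]
  refine sum_nonneg fun i _ => ?_
  rw [sum_comm]
  refine sum_nonneg fun k _ => ?_
  have h := hD.cubeExpect_cubeRestrict_mul_sq_nonneg S
    (fun x => (A * Matrix.of fun i' j => fourierLowPart S.1 d (fun y => B y i' j) x) i k)
    (fun α hα => cubeFourierCoeff_mul_fourierLowPart_eq_zero S.1 d A B i k hα)
  unfold cubeExpect at h
  have h2 : (0 : ℝ) < 2 ^ n := by positivity
  have := mul_nonneg h h2.le
  rwa [div_mul_cancel₀ _ h2.ne'] at this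

end Literature.Combinatorics.Optimization
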